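import Summits.CriticalPhenomena.PercolationContinuityZ3.Theorems.PercNearOneGluingNoHeavyLowerTailThreePointCPIPunctured
import Summits.CriticalPhenomena.PercolationContinuityZ3.Theorems.PercNearOneGluingNoHeavyLowerTailThreePointCPIReimer
import HarnessLib

/-!
# The one-sided part of `(★★)` and the reduction of the 3-point CPI₂ to the two-sided residual

Crux `stmt-CriticalPhenomena-4575`, route `PercNearOneGluingNoHeavy`, fibre line (facecert gen 27; memo
`prim-l12/prim-facecert/FINDING-gen27-PUNCTURED-INVOLUTION.md`).  Consequences of THEOREM A (`…ThreePointCPIPunctured.farFlip_mem_X5`):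

* `card_oneSided_le` — **unconditional**: for every finite multigraph and `c ∉ {s,b}`,
  `#{z : Y ∧ J ∧ D, R(z) one-sided} ≤ #{z : Y ∧ ¬J ∧ ¬D}` (the far flip `ι₀` is an injection).
* `starstar_of_twoSided` — `(★★)` follows from its restriction to the TWO-SIDED configurations against the targets not hit by
  `ι₀`:  `#{z ∈ X1 : ¬ one-sided} ≤ #{z ∈ X5 : ι₀ z ∉ X1}`  (`X1 = Y∧D∧J∧¬(Y□D)`, `X5 = Y∧¬J∧¬D`).
* `threePoint_cpi_two_of_twoSided` — hence the 3-point CPI₂ `B₃ ≤ 2A₃` follows from that residual inequality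
  (`…ThreePointCPIReimer.threePoint_cpi_two_of_starstar`).  When `c` is adjacent to `s` or `b` the residual is handled by
  `…ThreePointCPIAdjacentPort`; the residual class is ≈ 8 % of `X1` for `n ≤ 6` (facecert gen 27 census) and the residual
  inequality has no counterexample for `n ≤ 7`, `m ≤ 10` (it is equivalent to `(★★)`, kit j250194).
-/

namespace Summit.CriticalPhenomena.PercolationContinuityZ3.Theorems.ThreePointCPIPunctured

open Finset Literature.Probability.Percolation

variable {V α : Type*}

/-! ### Counting: the one-sided part of `(★★)` and the reduction to the two-sided part -/

section Counting

variable [Fintype α] [DecidableEq α] (ends : α → Sym2 V) (s b c : V)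

open Classical in
/-- **The one-sided part of `(★★)` (unconditional).** For every finite multigraph and `c ∉ {s,b}`:
`#{z : c ↔ {s,b}, s ↔ b open, s ↮ b closed, R(z) one-sided} ≤ #{z : c ↔ {s,b}, s ↮ b open, s ↔ b closed}`
— the far flip `ι₀` is an injection from the left set into the right set (`farFlip_mem_X5`,
`farFlip_farFlip`). [this work] -/
theorem card_oneSided_le (hcs : c ≠ s) (hcb : c ≠ b) :
    (univ.filter fun z : α → Bool =>
        ((openGraph (labelledOpen ends z)).Reachable c s ∨
          (openGraph (labelledOpen ends z)).Reachable c b) ∧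
        (openGraph (labelledOpen ends z)).Reachable s b ∧
        ¬ (openGraph (labelledOpen ends fun a => !z a)).Reachable s b ∧
        OneSided ends s b c z).card ≤
    (univ.filter fun z : α → Bool =>
        ((openGraph (labelledOpen ends z)).Reachable c s ∨
          (openGraph (labelledOpen ends z)).Reachable c b) ∧
        ¬ (openGraph (labelledOpen ends z)).Reachable s b ∧
        ¬ ¬ (openGraph (labelledOpen ends fun a => !z a)).Reachable s b).card := by
  by_cases hsb : s = b
  · -- then `s ↮ b closed` is impossible: the left set is empty
    subst hsb
    refine le_of_eq_of_le (Finset.card_eq_zero.2 ?_) (Nat.zero_le _)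
    refine filter_eq_empty_iff.2 fun z _ h => h.2.2.1 (SimpleGraph.Reachable.refl _)
  refine Finset.card_le_card_of_injOn (farFlip ends s b c) ?_ ?_
  · intro z hz
    rw [mem_coe, mem_filter] at hz
    obtain ⟨-, hY, hJ, hD, h1⟩ := hz
    obtain ⟨hY', hJ', hD'⟩ := farFlip_mem_X5 ends s b c z hcs hcb hsb hY hJ hD h1
    rw [mem_coe, mem_filter]
    exact ⟨mem_univ _, hY', hJ', not_not_intro hD'⟩
  · intro z _ z' _ h
    have := congrArg (farFlip ends s b c) h
    rwa [farFlip_farFlip ends s b c z hcs hcb, farFlip_farFlip ends s b c z' hcs hcb] at this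

open Classical in
/-- **Reduction of `(★★)` to the two-sided class.** For `c ∉ {s,b}`: `(★★)`
`#{Y ∧ D ∧ J ∧ ¬(Y □ D)} ≤ #{Y ∧ ¬J ∧ ¬D}` follows from the inequality for the TWO-SIDED
configurations only, against the targets not used by the far flip:
`#{Y ∧ D ∧ J ∧ ¬(Y□D) ∧ ¬OneSided} ≤ #{z ∈ Y ∧ ¬J ∧ ¬D : ι₀ z ∉ Y ∧ D ∧ J ∧ ¬(Y□D)}`.
Proof: `ι₀` injects the one-sided part into `Y ∧ ¬J ∧ ¬D` and, being an involution, its image is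
disjoint from the displayed target set. [this work] -/
theorem starstar_of_twoSided (hcs : c ≠ s) (hcb : c ≠ b)
    (hres : (univ.filter fun z : α → Bool =>
        (((openGraph (labelledOpen ends z)).Reachable c s ∨
          (openGraph (labelledOpen ends z)).Reachable c b) ∧
        ¬ (openGraph (labelledOpen ends fun a => !z a)).Reachable s b ∧
        (openGraph (labelledOpen ends z)).Reachable s b ∧
        ¬ (∃ K : Finset α,
          (∀ w : α → Bool, (∀ i ∈ K, w i = z i) →
            ((openGraph (labelledOpen ends w)).Reachable c s ∨
              (openGraph (labelledOpen ends w)).Reachable c b)) ∧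
          (∀ w : α → Bool, (∀ i, i ∉ K → w i = z i) →
            ¬ (openGraph (labelledOpen ends fun a => !w a)).Reachable s b))) ∧
        ¬ OneSided ends s b c z).card ≤
      (univ.filter fun z : α → Bool =>
        (((openGraph (labelledOpen ends z)).Reachable c s ∨
          (openGraph (labelledOpen ends z)).Reachable c b) ∧
        ¬ (openGraph (labelledOpen ends z)).Reachable s b ∧
        ¬ ¬ (openGraph (labelledOpen ends fun a => !z a)).Reachable s b) ∧
        ¬ (((openGraph (labelledOpen ends (farFlip ends s b c z))).Reachable c s ∨
          (openGraph (labelledOpen ends (farFlip ends s b c z))).Reachable c b) ∧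
        ¬ (openGraph (labelledOpen ends fun a => !(farFlip ends s b c z) a)).Reachable s b ∧
        (openGraph (labelledOpen ends (farFlip ends s b c z))).Reachable s b ∧
        ¬ (∃ K : Finset α,
          (∀ w : α → Bool, (∀ i ∈ K, w i = (farFlip ends s b c z) i) →
            ((openGraph (labelledOpen ends w)).Reachable c s ∨
              (openGraph (labelledOpen ends w)).Reachable c b)) ∧
          (∀ w : α → Bool, (∀ i, i ∉ K → w i = (farFlip ends s b c z) i) →
            ¬ (openGraph (labelledOpen ends fun a => !w a)).Reachable s b)))).card) :
    (univ.filter fun z : α → Bool =>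
        ((openGraph (labelledOpen ends z)).Reachable c s ∨
          (openGraph (labelledOpen ends z)).Reachable c b) ∧
        ¬ (openGraph (labelledOpen ends fun a => !z a)).Reachable s b ∧
        (openGraph (labelledOpen ends z)).Reachable s b ∧
        ¬ (∃ K : Finset α,
          (∀ w : α → Bool, (∀ i ∈ K, w i = z i) →
            ((openGraph (labelledOpen ends w)).Reachable c s ∨
              (openGraph (labelledOpen ends w)).Reachable c b)) ∧
          (∀ w : α → Bool, (∀ i, i ∉ K → w i = z i) →
            ¬ (openGraph (labelledOpen ends fun a => !w a)).Reachable s b))).card ≤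
      (univ.filter fun z : α → Bool =>
        ((openGraph (labelledOpen ends z)).Reachable c s ∨
          (openGraph (labelledOpen ends z)).Reachable c b) ∧
        ¬ (openGraph (labelledOpen ends z)).Reachable s b ∧
        ¬ ¬ (openGraph (labelledOpen ends fun a => !z a)).Reachable s b).card := by
  -- names for the two predicates
  set X1 : (α → Bool) → Prop := fun z =>
    ((openGraph (labelledOpen ends z)).Reachable c s ∨
      (openGraph (labelledOpen ends z)).Reachable c b) ∧
    ¬ (openGraph (labelledOpen ends fun a => !z a)).Reachable s b ∧
    (openGraph (labelledOpen ends z)).Reachable s b ∧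
    ¬ (∃ K : Finset α,
      (∀ w : α → Bool, (∀ i ∈ K, w i = z i) →
        ((openGraph (labelledOpen ends w)).Reachable c s ∨
          (openGraph (labelledOpen ends w)).Reachable c b)) ∧
      (∀ w : α → Bool, (∀ i, i ∉ K → w i = z i) →
        ¬ (openGraph (labelledOpen ends fun a => !w a)).Reachable s b)) with hX1
  set X5 : (α → Bool) → Prop := fun z =>
    ((openGraph (labelledOpen ends z)).Reachable c s ∨
      (openGraph (labelledOpen ends z)).Reachable c b) ∧
    ¬ (openGraph (labelledOpen ends z)).Reachable s b ∧
    ¬ ¬ (openGraph (labelledOpen ends fun a => !z a)).Reachable s b with hX5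
  change (univ.filter fun z => X1 z ∧ ¬ OneSided ends s b c z).card ≤
    (univ.filter fun z => X5 z ∧ ¬ X1 (farFlip ends s b c z)).card at hres
  change (univ.filter fun z => X1 z).card ≤ (univ.filter fun z => X5 z).card
  by_cases hsb : s = b
  · subst hsb
    refine le_of_eq_of_le (Finset.card_eq_zero.2 ?_) (Nat.zero_le _)
    exact filter_eq_empty_iff.2 fun z _ h => h.2.1 (SimpleGraph.Reachable.refl _)
  -- split X1 by one-sidedness
  have hsplit : (univ.filter fun z => X1 z).card =
      (univ.filter fun z => X1 z ∧ OneSided ends s b c z).card +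
        (univ.filter fun z => X1 z ∧ ¬ OneSided ends s b c z).card := by
    have h := card_filter_add_card_filter_not (s := univ.filter fun z => X1 z)
      (fun z => OneSided ends s b c z)
    rw [filter_filter, filter_filter] at h
    exact h.symm
  -- the image of the one-sided part under ι₀
  set S₁ := univ.filter fun z => X1 z ∧ OneSided ends s b c z with hS₁
  set F := univ.filter fun z => X5 z ∧ ¬ X1 (farFlip ends s b c z) with hF
  have himg : (S₁.image (farFlip ends s b c)).card = S₁.card := by
    refine card_image_of_injOn ?_
    intro z _ z' _ h
    have := congrArg (farFlip ends s b c) h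
    rwa [farFlip_farFlip ends s b c z hcs hcb, farFlip_farFlip ends s b c z' hcs hcb] at this
  have hsub : S₁.image (farFlip ends s b c) ∪ F ⊆ univ.filter fun z => X5 z := by
    intro y hy
    rcases mem_union.1 hy with hy | hy
    · obtain ⟨z, hz, rfl⟩ := mem_image.1 hy
      rw [hS₁, mem_filter] at hz
      obtain ⟨-, ⟨hY, hD, hJ, -⟩, h1⟩ := hz
      obtain ⟨hY', hJ', hD'⟩ := farFlip_mem_X5 ends s b c z hcs hcb hsb hY hJ hD h1
      exact mem_filter.2 ⟨mem_univ _, hY', hJ', not_not_intro hD'⟩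
    · rw [hF, mem_filter] at hy
      exact mem_filter.2 ⟨mem_univ _, hy.2.1⟩
  have hdisj : Disjoint (S₁.image (farFlip ends s b c)) F := by
    rw [disjoint_left]
    intro y hy hyF
    obtain ⟨z, hz, rfl⟩ := mem_image.1 hy
    rw [hS₁, mem_filter] at hz
    rw [hF, mem_filter] at hyF
    exact hyF.2.2 (by rw [farFlip_farFlip ends s b c z hcs hcb]; exact hz.2.1)
  calc (univ.filter fun z => X1 z).card
      = S₁.card + (univ.filter fun z => X1 z ∧ ¬ OneSided ends s b c z).card := hsplit
    _ ≤ S₁.card + F.card := Nat.add_le_add_left hres _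
    _ = (S₁.image (farFlip ends s b c) ∪ F).card := by rw [card_union_of_disjoint hdisj, himg]
    _ ≤ (univ.filter fun z => X5 z).card := card_le_card hsub

open Classical in
/-- **CPI₂ from the two-sided residual.** For every finite multigraph and `c ∉ {s,b}`: if the
two-sided configurations of `X1 = {Y ∧ D ∧ J ∧ ¬(Y□D)}` are at most the `X5 = {Y ∧ ¬J ∧ ¬D}`
configurations `z` with `ι₀ z ∉ X1`, then the 3-point CPI₂ `B₃ ≤ 2A₃` holds
(`starstar_of_twoSided` + `ThreePointCPIReimer.threePoint_cpi_two_of_starstar`). [this work] -/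
theorem threePoint_cpi_two_of_twoSided (hcs : c ≠ s) (hcb : c ≠ b)
    (hres : (univ.filter fun z : α → Bool =>
        (((openGraph (labelledOpen ends z)).Reachable c s ∨
          (openGraph (labelledOpen ends z)).Reachable c b) ∧
        ¬ (openGraph (labelledOpen ends fun a => !z a)).Reachable s b ∧
        (openGraph (labelledOpen ends z)).Reachable s b ∧
        ¬ (∃ K : Finset α,
          (∀ w : α → Bool, (∀ i ∈ K, w i = z i) →
            ((openGraph (labelledOpen ends w)).Reachable c s ∨
              (openGraph (labelledOpen ends w)).Reachable c b)) ∧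
          (∀ w : α → Bool, (∀ i, i ∉ K → w i = z i) →
            ¬ (openGraph (labelledOpen ends fun a => !w a)).Reachable s b))) ∧
        ¬ OneSided ends s b c z).card ≤
      (univ.filter fun z : α → Bool =>
        (((openGraph (labelledOpen ends z)).Reachable c s ∨
          (openGraph (labelledOpen ends z)).Reachable c b) ∧
        ¬ (openGraph (labelledOpen ends z)).Reachable s b ∧
        ¬ ¬ (openGraph (labelledOpen ends fun a => !z a)).Reachable s b) ∧
        ¬ (((openGraph (labelledOpen ends (farFlip ends s b c z))).Reachable c s ∨
          (openGraph (labelledOpen ends (farFlip ends s b c z))).Reachable c b) ∧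
        ¬ (openGraph (labelledOpen ends fun a => !(farFlip ends s b c z) a)).Reachable s b ∧
        (openGraph (labelledOpen ends (farFlip ends s b c z))).Reachable s b ∧
        ¬ (∃ K : Finset α,
          (∀ w : α → Bool, (∀ i ∈ K, w i = (farFlip ends s b c z) i) →
            ((openGraph (labelledOpen ends w)).Reachable c s ∨
              (openGraph (labelledOpen ends w)).Reachable c b)) ∧
          (∀ w : α → Bool, (∀ i, i ∉ K → w i = (farFlip ends s b c z) i) →
            ¬ (openGraph (labelledOpen ends fun a => !w a)).Reachable s b)))).card) :
    (univ.filter fun z : α → Bool =>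
        ¬ (openGraph (labelledOpen ends z)).Reachable s b ∧
        ((openGraph (labelledOpen ends fun a => !z a)).Reachable c s ∨
          (openGraph (labelledOpen ends fun a => !z a)).Reachable c b)).card ≤
      2 * (univ.filter fun z : α → Bool =>
        ¬ (openGraph (labelledOpen ends z)).Reachable s b ∧
        ((openGraph (labelledOpen ends z)).Reachable c s ∨
          (openGraph (labelledOpen ends z)).Reachable c b)).card :=
  ThreePointCPIReimer.threePoint_cpi_two_of_starstar ends s b c
    (starstar_of_twoSided ends s b c hcs hcb hres)

end Counting

end Summit.CriticalPhenomena.PercolationContinuityZ3.Theorems.ThreePointCPIPunctured
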